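/-
Copyright (c) 2026. All rights reserved.
Released under Apache 2.0 license as described in the file LICENSE.
Authors: HodgeCM publication cell (pub-hodgecm), GR lane, third hand (`pub-hodgecm-own-crow`).
-/
import Literature.NumberTheory.Automorphic.UnitaryGroupArchimedean
import Mathlib.Topology.Metrizable.Urysohn
import HarnessLib

/-!
# `U(J)(E ⊗ ℝ)` is a locally compact, second countable, metrizable topological group — as INSTANCES

Topic `NumberTheory/Automorphic`; namespace `Literature.NumberTheory.Automorphic.UnitaryGroup`.  KERNEL ONLY: `Prop`-valued
instances on the tree-defined type `UnitaryGroup.arch F E c N J` (`UnitaryGroupArchimedean`: the archimedean points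
`U(J)(E ⊗_ℚ ℝ) ≤ GL_N(E ⊗ ℝ)` of the unitary group of ANY `J ∈ M_N(E)` for any extension `E/F` with an automorphism `c`);
no definition, no named fact, nothing asserted.

`UnitaryGroup.arch F E c N J` is closed in `GL_N(E ⊗ ℝ)` (tree `isClosed_arch`), and `E ⊗ ℝ = mixedSpace E` is a
finite-dimensional real vector space; hence the group is locally compact, second countable, Hausdorff, metrizable and
`σ`-compact.  The first two facts exist in the tree as THEOREMS of the Shimura-ball lane
(`UnitaryGroup.locallyCompactSpace_arch`, `UnitaryGroup.secondCountableTopology_arch` in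
`AlgebraicGeometry/ShimuraVarieties/UnitaryBallAdelicLiftPetersson`, behind heavy imports); this light-weight file makes all
five available to instance resolution from `UnitaryGroupArchimedean` alone — the form consumed by the archimedean Weil-section
assembly of the GR lane (`SegalBargmann.continuous_tensorOp_apply` — Banach–Steinhaus — asks `[LocallyCompactSpace G]` for
the strong continuity `hsc` of `archLift` along `G = U(J)(E ⊗ ℝ)`), exactly as `UnitaryGroupOfFormAdelicTopology` does for
the adelic points `U(J)(𝐀_F)`.

* `instIsTopologicalGroupArch`, `instLocallyCompactSpaceArch`, `instSecondCountableTopologyArch`, `instT2SpaceArch`,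
  `instMetrizableSpaceArch`, `instSigmaCompactSpaceArch`.

## References
* [BorelJacquet1979] A. Borel, H. Jacquet, *Automorphic forms and automorphic representations*, Proc. Symp. Pure Math. 33
  (1979), §4.1 (`G_∞ = G(F ⊗ ℝ)` a real Lie group).
* [PlatonovRapinchuk1994] V. Platonov, A. Rapinchuk, *Algebraic Groups and Number Theory* (1994), §3.2 (real points of
  algebraic groups are locally compact, second countable).
* [HewittRoss1979] E. Hewitt, K. A. Ross, *Abstract Harmonic Analysis I*, 2nd ed. (1979), Thm. 8.3, Thm. 5.3.
-/

set_option autoImplicit false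

open NumberField NumberField.mixedEmbedding

namespace Literature.NumberTheory.Automorphic

namespace UnitaryGroup

variable (F E : Type) [Field F] [Field E] [NumberField E] [Algebra F E] (c : E ≃ₐ[F] E) (N : ℕ)
  (J : Matrix (Fin N) (Fin N) E)

/-- `GL_N(E ⊗ ℝ)` is locally compact: units of the locally compact Hausdorff ring `M_N(E ⊗ ℝ)`, closed in
`M_N(E ⊗ ℝ) × M_N(E ⊗ ℝ)ᵐᵒᵖ` under `g ↦ (g, g⁻¹)`. [cite: PlatonovRapinchuk1994, §3.2] -/
private theorem locallyCompactSpace_GL_mixedSpace : LocallyCompactSpace (GL (Fin N) (mixedSpace E)) := by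
  haveI : LocallyCompactSpace (Matrix (Fin N) (Fin N) (mixedSpace E)) :=
    inferInstanceAs (LocallyCompactSpace (Fin N → Fin N → mixedSpace E))
  infer_instance

/-- `GL_N(E ⊗ ℝ)` is second countable. [cite: PlatonovRapinchuk1994, §3.2] -/
private theorem secondCountableTopology_GL_mixedSpace : SecondCountableTopology (GL (Fin N) (mixedSpace E)) := by
  haveI : SecondCountableTopology (Matrix (Fin N) (Fin N) (mixedSpace E)) :=
    inferInstanceAs (SecondCountableTopology (Fin N → Fin N → mixedSpace E))
  haveI : SecondCountableTopology (Matrix (Fin N) (Fin N) (mixedSpace E))ᵐᵒᵖ :=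
    MulOpposite.opHomeomorph.symm.secondCountableTopology
  exact Units.isEmbedding_embedProduct.secondCountableTopology

omit [NumberField E] in
/-- **`U(J)(E ⊗ ℝ)` is a topological group** (a subgroup of the topological group `GL_N(E ⊗ ℝ)`).
[cite: BorelJacquet1979, §4.1] -/
instance instIsTopologicalGroupArch : IsTopologicalGroup (arch F E c N J) :=
  inferInstance

/-- **`U(J)(E ⊗ ℝ)` is locally compact** (closed in the locally compact `GL_N(E ⊗ ℝ)`, `isClosed_arch`; the same fact as
the Shimura-ball lane's theorem `locallyCompactSpace_arch`, here as an instance). [cite: BorelJacquet1979, §4.1]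
[cite: PlatonovRapinchuk1994, §3.2] -/
instance instLocallyCompactSpaceArch : LocallyCompactSpace (arch F E c N J) :=
  haveI := locallyCompactSpace_GL_mixedSpace E N
  (isClosed_arch F E c N J).locallyCompactSpace

/-- **`U(J)(E ⊗ ℝ)` is second countable** (a subspace of the second countable `GL_N(E ⊗ ℝ)`; the same fact as the
Shimura-ball lane's theorem `secondCountableTopology_arch`, here as an instance). [cite: PlatonovRapinchuk1994, §3.2] -/
instance instSecondCountableTopologyArch : SecondCountableTopology (arch F E c N J) :=
  haveI := secondCountableTopology_GL_mixedSpace E N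
  Topology.IsEmbedding.subtypeVal.secondCountableTopology

omit [NumberField E] in
/-- **`U(J)(E ⊗ ℝ)` is Hausdorff.** [cite: BorelJacquet1979, §4.1] -/
instance instT2SpaceArch : T2Space (arch F E c N J) :=
  inferInstance

/-- **`U(J)(E ⊗ ℝ)` is metrizable**: a Hausdorff topological group — hence `T₃` — with a countable base (Urysohn;
Birkhoff–Kakutani). [cite: HewittRoss1979, Thm. 8.3] -/
instance instMetrizableSpaceArch : TopologicalSpace.MetrizableSpace (arch F E c N J) :=
  TopologicalSpace.metrizableSpace_of_t3_secondCountable _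

/-- **`U(J)(E ⊗ ℝ)` is `σ`-compact** (locally compact with a countable base). [cite: HewittRoss1979, Thm. 5.3] -/
instance instSigmaCompactSpaceArch : SigmaCompactSpace (arch F E c N J) :=
  inferInstance

end UnitaryGroup

end Literature.NumberTheory.Automorphic
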